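import Summits.HodgeConjecture.HodgeConjecture.Theorems.Ring2HypothesesDescentFiniteEtaleBaseChange
import Summits.HodgeConjecture.HodgeConjecture.Theorems.Ring2HypothesesDescentMotivatedDeformationProjectiveBaseRows
import Literature.AlgebraicGeometry.Motives.JacobianHomology
import HarnessLib

/-!
# Ring 2 hypotheses, descent face — ROWS of the finite étale base change: the CM locus pulls back, the CM-pointed node
# `(5)_d` descends from the cover, and compact abelian pencils CONSTANT ON A CONNECTED FINITE ÉTALE COVER OF THE BASE
# (isotrivial-type pencils) satisfy `B⋆`, the repaired β-Lefschetz `(β′_f)` and Abdulali's transport UNCONDITIONALLY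

research route conditional on HC_CM; not a corollary; Q11.4-sentence-2 already refuted in dim ≥ 3.
Cell `pub-hodge-ring2` (Hodge ladder STAGE 3), seat `ring2-b05` (binder row b05
`Ring2.Hypotheses.MotivatedImpliesAlgebraicAV`, published modulo X = `Ring2.AbelianAll.LefschetzBCompactPencils`), gen 43,
second file (rows of `Ring2HypothesesDescentFiniteEtaleBaseChange`). `HC_CM` (`Theses.RankFourFaces.CMAbelianHodge`)
does not occur in this file; nothing here proves a case of the Hodge conjecture; no binder of `BINDER-OWNERS.md` is
discharged; row b05 and X stay OPEN. `B⋆` upstairs occurs only as a displayed HYPOTHESIS, except in §3 where it is PROVED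
for the pencils in question.

* §1 `mem_cmLocus_familyPullback_snd_iff`, `cmLocus_familyPullback_snd_nonempty` — the CM locus of the pulled-back pencil
  is the preimage of the CM locus (`fiberOverFamilyPullbackIso`); it is non-empty when the CM locus downstairs is (a finite
  étale cover of the irreducible base curve is surjective on complex points, `AlgPoints.map_surjective_of_surjective`).
* §2 `lefschetzBCMPointedPencilsAtRelDim_of_forall_exists_familyPullback` — **the CM-pointed node `(5)_d` descends**: if for
  every CM-pointed compact pencil of abelian `d`-folds SOME connected finite étale base change has a total space satisfying
  `B⋆` in every polarisation, then `(5)_d`; and the pulled-back pencil is again CM-pointed (§1), so `(5)_d` may be ASSUMED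
  upstairs (`lefschetzB_cmPointed_pencil_of_familyPullback`); **both graded nodes `(5∀)_d`, `(5)_d` are INVARIANT under
  connected finite étale base change** (`lefschetzBCompactPencilsAtRelDim_iff_forall_familyPullback`,
  `lefschetzBCMPointedPencilsAtRelDim_iff_forall_familyPullback`).
* §3 **ISOTRIVIAL-TYPE PENCILS, UNCONDITIONALLY**: `standardConjectureBStar_abelianVariety_tensor_curve` (`B⋆(A × C, θ)` for
  every abelian `A`, smooth projective curve `C`, every `θ` — Lieberman + `B` for curves + Kleiman's product theorem, all
  tree theorems); `lefschetzB_pencil_of_surjective_const` (**a compact abelian pencil whose total space is a surjective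
  image of some `A × C` satisfies `B⋆` in every polarisation**); `lefschetzB_pencil_of_familyPullback_of_surjective_const`
  (**the same when only the PULLED-BACK pencil along a connected finite étale cover is such an image — e.g. a pencil that
  becomes constant, `𝒳 ×_S S' ≅ A × S'`, on a finite étale cover: `lefschetzB_pencil_of_familyPullback_iso_const`**).
  This is the isotrivial residue of X named by gen 42 («the β-column's d = 2 residual is the ISOTRIVIAL case … needs an
  isotriviality structure theorem not in the tree»): the STRUCTURE theorem (all fibres isomorphic ⟹ constant on a finite
  étale cover) is NOT proved here and NOT assumed as a named fact — the trivialisation is the displayed hypothesis.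
* §4 consequences along the tree's unconditional rows: `(β′_f)` (`fibreClassLefschetzOn_of_familyPullback`, via gen 42's
  `fibreClassLefschetzOn_of_lefschetzB`) and Abdulali's transport of algebraicity `InvariantCyclesHoldFor f d`
  (`invariantCyclesHoldFor_of_familyPullback`) for every compact abelian pencil whose pulled-back total space satisfies
  `B⋆`; unconditional instances for the isotrivial-type pencils of §3.

HONEST COLUMN. No definition, no named fact, no sorry. The open content of X is untouched for pencils that are NOT
constant on a finite étale cover (e.g. the CM-anchored pencils of Lemme 6.3.1, which have a CM fibre and a fibre
isogenous to `A × A`, hence are non-isotrivial unless `A` is CM). References: Andre1996Motifs (§5.3 p. 30, §6.3 Remarque 2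
p. 33), Arapura2006 (§1 Cor. 1.2, §4 Lemma 4.2), Kleiman1968AlgebraicCycles (Cor. 2.5, 2A11), Lieberman1968,
Abdulali1994FamiliesAV ((1.1), Conj. 5.3), MumfordGIT (Thm. 6.14), SGA1 (I §9, XII 2.4).
-/

noncomputable section

-- every declaration of this problem lives in `Summit.HodgeConjecture.HodgeConjecture.…` (summit = sub-problem)
set_option linter.dupNamespace false

open CategoryTheory CategoryTheory.Limits AlgebraicGeometry MonoidalCategory
open _root_.Topology
open Literature.AlgebraicGeometry Literature.AlgebraicGeometry.Motives Literature.AlgebraicGeometry.HodgeTheory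
open Literature.AlgebraicGeometry.Milne1999 (IsOfCMType)
open Literature.AlgebraicGeometry.Deligne1982 (cmLocus)
open Literature.AlgebraicGeometry.Abdulali1994 (InvariantCyclesHoldFor)
open Summit.HodgeConjecture.HodgeConjecture.Ring2.AbelianAll

namespace Summit.HodgeConjecture.HodgeConjecture.Theorems

variable {d : ℕ} {𝒳 S S' : SchemeOver ℂ} {f : 𝒳 ⟶ S}

/-! ## §1 The CM locus of the pulled-back pencil -/

/-- **The CM locus pulls back**: `s'` lies in the CM locus of `𝒳 ×_S S' ⟶ S'` iff `g(s')` lies in the CM locus of `f`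
(the fibres agree, `fiberOverFamilyPullbackIso`). [cite: Deligne1982HodgeCycles, §6 proof of Prop. 6.1 (the CM locus)] -/
theorem mem_cmLocus_familyPullback_snd_iff (f : 𝒳 ⟶ S) (g : S' ⟶ S) (n : ℕ) (s' : ComplexPoints S') :
    s' ∈ cmLocus (familyPullback.snd f g) n ↔ AlgPoints.map g s' ∈ cmLocus f n := by
  simp only [Deligne1982.mem_cmLocus_iff]
  constructor
  · rintro ⟨A₀, ⟨e⟩, hdim, hCM⟩
    exact ⟨A₀, ⟨e ≪≫ fiberOverFamilyPullbackIso f g s'⟩, hdim, hCM⟩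
  · rintro ⟨A₀, ⟨e⟩, hdim, hCM⟩
    exact ⟨A₀, ⟨e ≪≫ (fiberOverFamilyPullbackIso f g s').symm⟩, hdim, hCM⟩

/-- **A CM-pointed compact pencil stays CM-pointed after a connected finite étale base change**: the cover `g : S' ⟶ S`
is surjective (finite étale from a non-empty scheme onto the irreducible base curve), hence surjective on complex points
(`AlgPoints.map_surjective_of_surjective`), so a CM point of `f` lifts. [cite: SGA1, Exp. I §9 and Exp. XII Prop. 2.4] -/
theorem cmLocus_familyPullback_snd_nonempty (hf : IsCompactAbelianPencil f d) (g : S' ⟶ S) [IsFinite g.left]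
    [Etale g.left] [ConnectedSpace (ComplexPoints S')] (h : (cmLocus f d).Nonempty) :
    (cmLocus (familyPullback.snd f g) d).Nonempty := by
  obtain ⟨t, ht⟩ := h
  haveI := hf.isSmoothProjective_base.smoothOfRelativeDimension
  haveI hS'd : SmoothOfRelativeDimension 1 S'.hom := by
    have h : SmoothOfRelativeDimension (0 + 1) (g.left ≫ S.hom) := inferInstance
    rw [Over.w] at h
    simpa using h
  haveI : Smooth S'.hom := SmoothOfRelativeDimension.smooth 1 _
  haveI : Smooth S.hom := SmoothOfRelativeDimension.smooth 1 _
  haveI : IrreducibleSpace S'.left := irreducibleSpace_left_of_connectedSpace_complexPoints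
  haveI : Nonempty S'.left := inferInstance
  haveI : IrreducibleSpace S.left := hf.isSmoothProjective_base.irreducibleSpace
  haveI : Surjective g.left := surjective_of_isFinite_of_etale_of_irreducible g.left
  haveI : LocallyOfFiniteType S'.hom := inferInstance
  haveI : LocallyOfFiniteType S.hom := inferInstance
  obtain ⟨s', hs'⟩ := AlgPoints.map_surjective_of_surjective g t
  exact ⟨s', (mem_cmLocus_familyPullback_snd_iff f g d s').2 (hs' ▸ ht)⟩

/-! ## §2 The CM-pointed node `(5)_d` descends from the cover -/

/-- **`B⋆` for a CM-pointed pencil from the pulled-back (again CM-pointed) pencil**: if `B⋆` upstairs is known for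
CM-pointed compact pencils of abelian `d`-folds (`(5)_d`-shaped hypothesis, applied to ONE cover), it holds downstairs.
The hypothesis is NOT asserted. [cite: Andre1996Motifs, Lemme 6.3.1 (ii) (p. 31) and Remarque 2 (p. 33)] -/
theorem lefschetzB_cmPointed_pencil_of_familyPullback (hf : IsCompactAbelianPencil f d) (hcm : (cmLocus f d).Nonempty)
    (g : S' ⟶ S) [IsFinite g.left] [Etale g.left] [ConnectedSpace (ComplexPoints S')]
    (hB : (cmLocus (familyPullback.snd f g) d).Nonempty →
      ∀ η' : complexBetti (familyPullback f g) 2, StandardConjectureBStar (d + 1) (familyPullback f g) η')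
    (η : complexBetti 𝒳 2) : StandardConjectureBStar (d + 1) 𝒳 η :=
  lefschetzB_pencil_of_familyPullback hf g (hB (cmLocus_familyPullback_snd_nonempty hf g hcm)) η

/-- **The CM-pointed graded node `(5)_d` (`Ring2.AbelianAll.LefschetzBCMPointedPencilsAtRelDim d`) descends from connected
finite étale base changes**: it suffices that every CM-pointed compact pencil of abelian `d`-folds admit SOME connected
finite étale base change whose (CM-pointed) total space satisfies `B⋆` in every polarisation.
[cite: Andre1996Motifs, §6.3 Remarque 2 (p. 33) and §5.3 (p. 30)] -/
theorem lefschetzBCMPointedPencilsAtRelDim_of_forall_exists_familyPullback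
    (h : ∀ ⦃𝒳 S : SchemeOver ℂ⦄ (f : 𝒳 ⟶ S), IsCompactAbelianPencil f d → (cmLocus f d).Nonempty →
      ∃ (S' : SchemeOver ℂ) (g : S' ⟶ S) (_ : IsFinite g.left) (_ : Etale g.left)
        (_ : ConnectedSpace (ComplexPoints S')),
        ∀ η' : complexBetti (familyPullback f g) 2, StandardConjectureBStar (d + 1) (familyPullback f g) η') :
    LefschetzBCMPointedPencilsAtRelDim d := by
  intro 𝒳 S f hf hcm η
  obtain ⟨S', g, hg₁, hg₂, hS', hB⟩ := h f hf hcm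
  exact lefschetzB_pencil_of_familyPullback hf g hB η

/-- **The graded node `(5∀)_d` is INVARIANT under connected finite étale base change**: `(5∀)_d` holds iff `B⋆` holds
in every polarisation for the total space of EVERY connected finite étale base change of every compact pencil of abelian
`d`-folds (⟹: the pulled-back pencil is again a compact abelian pencil, gen 43 `isCompactAbelianPencil_familyPullback_snd`;
⟸: take the identity cover… rather ANY cover and descend, gen 43 `lefschetzB_pencil_of_familyPullback` — here the
identity `𝟙 S`, a finite étale cover with connected complex points). [cite: Andre1996Motifs, §6.3 Remarque 2 (p. 33)] -/
theorem lefschetzBCompactPencilsAtRelDim_iff_forall_familyPullback :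
    LefschetzBCompactPencilsAtRelDim d ↔
      ∀ ⦃𝒳 S S' : SchemeOver ℂ⦄ (f : 𝒳 ⟶ S), IsCompactAbelianPencil f d →
        ∀ (g : S' ⟶ S) [IsFinite g.left] [Etale g.left] [ConnectedSpace (ComplexPoints S')]
          (η' : complexBetti (familyPullback f g) 2), StandardConjectureBStar (d + 1) (familyPullback f g) η' := by
  refine ⟨fun h 𝒳 S S' f hf g _ _ _ η' ↦ h (familyPullback.snd f g) (isCompactAbelianPencil_familyPullback_snd hf g) η',
    fun h 𝒳 S f hf η ↦ ?_⟩
  haveI : ConnectedSpace (ComplexPoints S) := connectedSpace_complexPoints hf.isSmoothProjective_base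
  haveI : IsFinite (𝟙 S : S ⟶ S).left := by rw [Over.id_left]; infer_instance
  haveI : Etale (𝟙 S : S ⟶ S).left := by rw [Over.id_left]; infer_instance
  exact lefschetzB_pencil_of_familyPullback hf (𝟙 S) (fun η' ↦ h f hf (𝟙 S) η') η

/-- **The CM-pointed graded node `(5)_d` is invariant under connected finite étale base change** likewise (CM-pointed
pencils pull back to CM-pointed pencils, §1). [cite: Andre1996Motifs, Lemme 6.3.1 (ii) (p. 31) and Remarque 2 (p. 33)] -/
theorem lefschetzBCMPointedPencilsAtRelDim_iff_forall_familyPullback :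
    LefschetzBCMPointedPencilsAtRelDim d ↔
      ∀ ⦃𝒳 S S' : SchemeOver ℂ⦄ (f : 𝒳 ⟶ S), IsCompactAbelianPencil f d → (cmLocus f d).Nonempty →
        ∀ (g : S' ⟶ S) [IsFinite g.left] [Etale g.left] [ConnectedSpace (ComplexPoints S')]
          (η' : complexBetti (familyPullback f g) 2), StandardConjectureBStar (d + 1) (familyPullback f g) η' := by
  refine ⟨fun h 𝒳 S S' f hf hcm g _ _ _ η' ↦ h (familyPullback.snd f g) (isCompactAbelianPencil_familyPullback_snd hf g)
    (cmLocus_familyPullback_snd_nonempty hf g hcm) η', fun h 𝒳 S f hf hcm η ↦ ?_⟩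
  haveI : ConnectedSpace (ComplexPoints S) := connectedSpace_complexPoints hf.isSmoothProjective_base
  haveI : IsFinite (𝟙 S : S ⟶ S).left := by rw [Over.id_left]; infer_instance
  haveI : Etale (𝟙 S : S ⟶ S).left := by rw [Over.id_left]; infer_instance
  exact lefschetzB_pencil_of_familyPullback hf (𝟙 S) (fun η' ↦ h f hf hcm (𝟙 S) η') η

/-! ## §3 Isotrivial-type pencils: constant on a connected finite étale cover ⟹ `B⋆`, unconditionally -/

/-- **`B⋆(A × C, θ)` for every complex abelian variety `A`, every smooth projective complex curve `C`, every `θ`,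
UNCONDITIONALLY** (Lieberman's `B(A)`, `B` for curves, Kleiman's product theorem — ab-andre-1's
`standardConjectureBStar_abelianVariety_tensor` with the literature seat's `standardConjectureBStar_curve`).
[cite: Lieberman1968, main theorem] [cite: Kleiman1968AlgebraicCycles, §2 Cor. 2.5 and 2A11] -/
theorem standardConjectureBStar_abelianVariety_tensor_curve (A : AbelianVariety ℂ) {C : SchemeOver ℂ}
    (hC : IsSmoothProjective 1 C) (θ : complexBetti (A.X ⊗ C) 2) : StandardConjectureBStar (A.dim + 1) (A.X ⊗ C) θ := by
  obtain ⟨ηC, hηC⟩ := exists_isPolarizationClass hC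
  exact standardConjectureBStar_abelianVariety_tensor A hC hηC (standardConjectureBStar_curve hC ηC) θ

/-- **A compact pencil of abelian `d`-folds whose total space is a surjective image of `A × C` (`A` abelian, `C` a smooth
projective curve) satisfies `B⋆(𝒳, η)` for every `η`, UNCONDITIONALLY** — e.g. the constant pencils `A × C → C`
themselves, their quotients by finite groups acting fibrewise, pencils dominated by a constant one (gen 41's descent of
`B⋆` along surjections). [cite: Arapura2006, §1 Cor. 1.2 and §4 Lemma 4.2] [cite: Lieberman1968, main theorem] -/
theorem lefschetzB_pencil_of_surjective_const (hf : IsCompactAbelianPencil f d) (A : AbelianVariety ℂ) {C : SchemeOver ℂ}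
    (hC : IsSmoothProjective 1 C) (φ : A.X ⊗ C ⟶ 𝒳) [Surjective φ.left] (η : complexBetti 𝒳 2) :
    StandardConjectureBStar (d + 1) 𝒳 η :=
  standardConjectureBStar_of_surjective_of_forall ((AbelianVariety.isSmoothProjective_holds (A := A)).tensor_holds hC)
    hf.isSmoothProjective_total φ (standardConjectureBStar_abelianVariety_tensor_curve A hC) η

/-- **ISOTRIVIAL-TYPE PENCILS: if the pulled-back pencil `𝒳 ×_S S' ⟶ S'` along a connected finite étale cover `S' → S`
has total space a surjective image of some `A × C`, then `B⋆(𝒳, η)` for every `η`, UNCONDITIONALLY** (§3's first row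
upstairs — the pulled-back pencil is a compact abelian pencil, gen 43 `isCompactAbelianPencil_familyPullback_snd` — then
descent along `𝒳 ×_S S' ⟶ 𝒳`, gen 43 `lefschetzB_pencil_of_familyPullback`). [cite: Arapura2006, §4 Lemma 4.2]
[cite: Andre1996Motifs, §6.3 Remarque 2 (p. 33)] -/
theorem lefschetzB_pencil_of_familyPullback_of_surjective_const (hf : IsCompactAbelianPencil f d) (g : S' ⟶ S)
    [IsFinite g.left] [Etale g.left] [ConnectedSpace (ComplexPoints S')] (A : AbelianVariety ℂ) {C : SchemeOver ℂ}
    (hC : IsSmoothProjective 1 C) (φ : A.X ⊗ C ⟶ familyPullback f g) [Surjective φ.left] (η : complexBetti 𝒳 2) :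
    StandardConjectureBStar (d + 1) 𝒳 η :=
  lefschetzB_pencil_of_familyPullback hf g
    (lefschetzB_pencil_of_surjective_const (isCompactAbelianPencil_familyPullback_snd hf g) A hC φ) η

/-- **A compact abelian pencil that becomes CONSTANT on a connected finite étale cover of the base** — an isomorphism of
`ℂ`-schemes `A × S' ≅ 𝒳 ×_S S'` for some abelian variety `A` — **satisfies `B⋆(𝒳, η)` for every `η`, UNCONDITIONALLY.**
(The structure theorem «all fibres isomorphic ⟹ constant on a finite étale cover» is NOT used or claimed: the
trivialisation is the hypothesis.) [cite: Arapura2006, §4 Lemma 4.2] [cite: MumfordGIT, Thm. 6.14] -/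
theorem lefschetzB_pencil_of_familyPullback_iso_const (hf : IsCompactAbelianPencil f d) (g : S' ⟶ S)
    [IsFinite g.left] [Etale g.left] [ConnectedSpace (ComplexPoints S')] (A : AbelianVariety ℂ)
    (e : A.X ⊗ S' ≅ familyPullback f g) (η : complexBetti 𝒳 2) : StandardConjectureBStar (d + 1) 𝒳 η := by
  haveI : IsIso e.hom.left := inferInstanceAs (IsIso ((Over.forget _).map e.hom))
  exact lefschetzB_pencil_of_familyPullback_of_surjective_const hf g A
    (isSmoothProjective_of_isFinite_of_etale hf.isSmoothProjective_base g) e.hom η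

/-! ## §4 Consequences: the repaired β-Lefschetz and Abdulali's transport -/

/-- **`(β′_f)` for a compact abelian pencil whose PULLED-BACK total space satisfies `B⋆`** (descent, then gen 42's
unconditional `fibreClassLefschetzOn_of_lefschetzB`). The hypothesis upstairs is NOT asserted.
[cite: Abdulali1994FamiliesAV, Conjecture 5.3 (p. 1130)] [cite: Andre1996Motifs, Thm. 0.4 (p. 8)] -/
theorem fibreClassLefschetzOn_of_familyPullback (hf : IsCompactAbelianPencil f d) (g : S' ⟶ S) [IsFinite g.left]
    [Etale g.left] [ConnectedSpace (ComplexPoints S')]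
    (hB : ∀ η' : complexBetti (familyPullback f g) 2, StandardConjectureBStar (d + 1) (familyPullback f g) η') :
    FibreClassLefschetzOn hf :=
  fibreClassLefschetzOn_of_lefschetzB hf (lefschetzB_pencil_of_familyPullback hf g hB)

/-- **Abdulali's transport of algebraicity (his (1.1)) along a compact abelian pencil whose pulled-back total space
satisfies `B⋆`**: a global class algebraic on one fibre is algebraic on every fibre. The hypothesis upstairs is NOT
asserted. [cite: Abdulali1994FamiliesAV, (1.1) (p. 1122) and Theorem 5.5 (p. 1130)] [cite: Milne2020HodgeClassesAV, Prop. 1 (p. 7)] -/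
theorem invariantCyclesHoldFor_of_familyPullback (hf : IsCompactAbelianPencil f d) (g : S' ⟶ S) [IsFinite g.left]
    [Etale g.left] [ConnectedSpace (ComplexPoints S')]
    (hB : ∀ η' : complexBetti (familyPullback f g) 2, StandardConjectureBStar (d + 1) (familyPullback f g) η') :
    InvariantCyclesHoldFor f d :=
  invariantCyclesHoldFor_of_fibreClassLefschetzOn hf (fibreClassLefschetzOn_of_familyPullback hf g hB)

/-- **Isotrivial-type pencils satisfy `(β′_f)` and Abdulali's transport, UNCONDITIONALLY** (pulled-back total space a
surjective image of `A × C`). [cite: Abdulali1994FamiliesAV, (1.1) and Conjecture 5.3] [cite: Lieberman1968, main theorem] -/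
theorem fibreClassLefschetzOn_and_invariantCyclesHoldFor_of_familyPullback_of_surjective_const
    (hf : IsCompactAbelianPencil f d) (g : S' ⟶ S) [IsFinite g.left] [Etale g.left]
    [ConnectedSpace (ComplexPoints S')] (A : AbelianVariety ℂ) {C : SchemeOver ℂ} (hC : IsSmoothProjective 1 C)
    (φ : A.X ⊗ C ⟶ familyPullback f g) [Surjective φ.left] :
    FibreClassLefschetzOn hf ∧ InvariantCyclesHoldFor f d :=
  have hB := lefschetzB_pencil_of_surjective_const (isCompactAbelianPencil_familyPullback_snd hf g) A hC φ
  ⟨fibreClassLefschetzOn_of_familyPullback hf g hB, invariantCyclesHoldFor_of_familyPullback hf g hB⟩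

end Summit.HodgeConjecture.HodgeConjecture.Theorems

end
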